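import Mathlib
import Literature.MathematicalPhysics.QuantumFieldTheory.OSData
import Literature.Analysis.FunctionSpaces.SchwartzTranslationAverage
import Literature.MathematicalPhysics.QuantumLattice.SchwartzTensorLineDeriv
import Literature.MathematicalPhysics.QuantumFieldTheory.OSSkeletonExplicitBounds
import HarnessLib

/-!
# `ContinuumLegGivenGap` — line `duality-selection-nlo-skewness`, stub `stub_nonnegSeparated`

Crux `stmt-QuantumFields-15828` (`Summit.QuantumFields.YangMills.Theses.ComplexCouplingChannel.ContinuumLegGivenGap`),
Källén–Lehmann blueprint step (P2): **non-negativity of the truncated two-point Schwinger functional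
`W(f, g) = 𝔖₂(f ⊗ g) − 𝔖₁(f) 𝔖₁(g)` on real non-negative pairs with separated supports**, GIVEN
(as hypotheses) bump-pair non-negativity `0 ≤ Re W(φₙ(· − a), φₙ(· − b))` for `dist a b > 2 rₙ` of a
shrinking kernel family `φₙ` and its approximate-identity property `φₙ ⋆ u → u` in `𝒮`.

Proof (def-free bookkeeping over the tree):

* the slots of `SchwartzMap.tensorFin 2 ![u, v]` and the lift `SchwartzMap.tensorFin 1 ![u]` are
  continuous linear (`tensorSnocLeft` / `tensorSnocRight` of `SchwartzTensorLineDeriv`);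
* SUPERPOSITION: the exchange lemma `SchwartzAverage.integral_mul_apply_compSubConstCLM`
  (`SchwartzTranslationAverage`) applied slot by slot gives
  `W(f ⋆ φ, g ⋆ φ) = ∫ f(a) ∫ g(b) W(φ(· − a), φ(· − b)) db da` (`truncated_translationAverage`), after
  commuting the convolution (`translationAverage_comm`, the substitution `a ↦ x − a`);
* SIGN: the integrand has non-negative real part (charged pairs are `δ > 2 rₙ` apart), and
  `0 ≤ Re ∫` follows pointwise (`re_integral_nonneg`);
* LIMIT: `W(φₙ ⋆ f, φₙ ⋆ g) → W(f, g)` by joint continuity of `tensorFin` (`continuous_tensorFin`)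
  and continuity of `𝔖₂`, `𝔖₁`, `re`; `ge_of_tendsto`.
-/

noncomputable section

namespace Summit.QuantumFields.YangMills.Cruxes.ContinuumLegGivenGap.DualitySelectionNloSkewness

open scoped SchwartzMap
open Filter Topology MeasureTheory Literature.MathematicalPhysics.QuantumFieldTheory
  Literature.MathematicalPhysics.QuantumLattice Literature.MathematicalPhysics.AQFT
  Literature.Analysis.FunctionSpaces

/-! ### The slots of a two-point tensor are continuous linear -/

section TensorCLM

variable {E : Type*} [NormedAddCommGroup E] [NormedSpace ℝ E]

/-- The first slot of `w ⊗ v = tensorFin 2 ![w, v]` is continuous linear in `w`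
(`tensorSnocLeft v ∘ tensorSnocRight 1`). [folklore] -/
theorem exists_clm_tensorFin_two_left (v : 𝓢(E, ℂ)) :
    ∃ L : 𝓢(E, ℂ) →L[ℂ] 𝓢((Fin 2 → E), ℂ), ∀ w, L w = SchwartzMap.tensorFin 2 ![w, v] := by
  refine ⟨(tensorSnocLeft v).comp (tensorSnocRight (SchwartzMap.tensorFin 0 ![])), fun w => ?_⟩
  ext z
  simp [Fin.prod_univ_two, Fin.init]

/-- The second slot of `u ⊗ w = tensorFin 2 ![u, w]` is continuous linear in `w`
(`tensorSnocRight (tensorFin 1 ![u])`). [folklore] -/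
theorem exists_clm_tensorFin_two_right (u : 𝓢(E, ℂ)) :
    ∃ R : 𝓢(E, ℂ) →L[ℂ] 𝓢((Fin 2 → E), ℂ), ∀ w, R w = SchwartzMap.tensorFin 2 ![u, w] := by
  refine ⟨tensorSnocRight (SchwartzMap.tensorFin 1 ![u]), fun w => ?_⟩
  ext z
  simp [Fin.prod_univ_two, Fin.init]

/-- The one-point lift `w ↦ tensorFin 1 ![w]` is continuous linear (`tensorSnocRight 1`). [folklore] -/
theorem exists_clm_tensorFin_one :
    ∃ L : 𝓢(E, ℂ) →L[ℂ] 𝓢((Fin 1 → E), ℂ), ∀ w, L w = SchwartzMap.tensorFin 1 ![w] := by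
  refine ⟨tensorSnocRight (SchwartzMap.tensorFin 0 ![]), fun w => ?_⟩
  ext z
  simp

end TensorCLM

/-! ### Superposition of translates, slot by slot -/

section Superposition

variable {V : Type*} [NormedAddCommGroup V] [InnerProductSpace ℝ V] [FiniteDimensional ℝ V]
  [MeasurableSpace V] [BorelSpace V]

/-- **Convolution is commutative**: `∫ h(a) u(x − a) da = ∫ u(a) h(x − a) da`, i.e. the averaging
operator of `SchwartzTranslationAverage` is symmetric in weight and argument (substitution
`a ↦ x − a`, `integral_sub_left_eq_self`). [folklore] -/
theorem translationAverage_comm (h u : 𝓢(V, ℂ)) :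
    SchwartzAverage.translationAverage (ContinuousLinearMap.id ℝ V) h u =
      SchwartzAverage.translationAverage (ContinuousLinearMap.id ℝ V) u h := by
  ext x
  rw [SchwartzAverage.translationAverage_apply, SchwartzAverage.translationAverage_apply]
  simp only [ContinuousLinearMap.coe_id', id_eq]
  rw [← integral_sub_left_eq_self (fun a => u a * h (x - a)) volume x]
  refine integral_congr_ae (Eventually.of_forall fun a => ?_)
  simp only [sub_sub_cancel]
  ring

/-- Superposition in the first slot: `𝔖₂((h ⋆ u) ⊗ v) = ∫ h(a) 𝔖₂(u(· − a) ⊗ v) da`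
(exchange lemma for the functional `𝔖₂ ∘ (· ⊗ v)`). [folklore] -/
theorem apply_tensorFin_two_translationAverage_left (S₂ : 𝓢((Fin 2 → V), ℂ) →L[ℂ] ℂ)
    (h u v : 𝓢(V, ℂ)) :
    S₂ (SchwartzMap.tensorFin 2
        ![SchwartzAverage.translationAverage (ContinuousLinearMap.id ℝ V) h u, v]) =
      ∫ a, h a * S₂ (SchwartzMap.tensorFin 2 ![SchwartzMap.compSubConstCLM ℂ a u, v]) := by
  obtain ⟨L, hL⟩ := exists_clm_tensorFin_two_left (E := V) v
  simp_rw [← hL]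
  have key := SchwartzAverage.integral_mul_apply_compSubConstCLM (ContinuousLinearMap.id ℝ V) h
    (S₂.comp L) u
  simp only [ContinuousLinearMap.coe_comp, Function.comp_apply, ContinuousLinearMap.coe_id',
    id_eq] at key
  exact key.symm

/-- Superposition in the second slot: `𝔖₂(u ⊗ (h ⋆ v)) = ∫ h(b) 𝔖₂(u ⊗ v(· − b)) db`. [folklore] -/
theorem apply_tensorFin_two_translationAverage_right (S₂ : 𝓢((Fin 2 → V), ℂ) →L[ℂ] ℂ)
    (h u v : 𝓢(V, ℂ)) :
    S₂ (SchwartzMap.tensorFin 2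
        ![u, SchwartzAverage.translationAverage (ContinuousLinearMap.id ℝ V) h v]) =
      ∫ b, h b * S₂ (SchwartzMap.tensorFin 2 ![u, SchwartzMap.compSubConstCLM ℂ b v]) := by
  obtain ⟨R, hR⟩ := exists_clm_tensorFin_two_right (E := V) u
  simp_rw [← hR]
  have key := SchwartzAverage.integral_mul_apply_compSubConstCLM (ContinuousLinearMap.id ℝ V) h
    (S₂.comp R) v
  simp only [ContinuousLinearMap.coe_comp, Function.comp_apply, ContinuousLinearMap.coe_id',
    id_eq] at key
  exact key.symm

/-- Superposition for the one-point function: `𝔖₁(h ⋆ u) = ∫ h(a) 𝔖₁(u(· − a)) da`. [folklore] -/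
theorem apply_tensorFin_one_translationAverage (S₁ : 𝓢((Fin 1 → V), ℂ) →L[ℂ] ℂ)
    (h u : 𝓢(V, ℂ)) :
    S₁ (SchwartzMap.tensorFin 1 ![SchwartzAverage.translationAverage (ContinuousLinearMap.id ℝ V) h u]) =
      ∫ a, h a * S₁ (SchwartzMap.tensorFin 1 ![SchwartzMap.compSubConstCLM ℂ a u]) := by
  obtain ⟨L, hL⟩ := exists_clm_tensorFin_one (E := V)
  simp_rw [← hL]
  have key := SchwartzAverage.integral_mul_apply_compSubConstCLM (ContinuousLinearMap.id ℝ V) h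
    (S₁.comp L) u
  simp only [ContinuousLinearMap.coe_comp, Function.comp_apply, ContinuousLinearMap.coe_id',
    id_eq] at key
  exact key.symm

/-- Integrability of `a ↦ h(a) 𝔖₂(u(· − a) ⊗ v)`. [folklore] -/
theorem integrable_mul_apply_tensorFin_two_left (S₂ : 𝓢((Fin 2 → V), ℂ) →L[ℂ] ℂ)
    (h u v : 𝓢(V, ℂ)) :
    Integrable fun a : V => h a * S₂ (SchwartzMap.tensorFin 2 ![SchwartzMap.compSubConstCLM ℂ a u, v]) := by
  obtain ⟨L, hL⟩ := exists_clm_tensorFin_two_left (E := V) v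
  simp_rw [← hL]
  have key := SchwartzAverage.integrable_mul_apply_compSubConstCLM (ContinuousLinearMap.id ℝ V) h
    (S₂.comp L) u
  simp only [ContinuousLinearMap.coe_comp, Function.comp_apply, ContinuousLinearMap.coe_id',
    id_eq] at key
  exact key

/-- Integrability of `b ↦ h(b) 𝔖₂(u ⊗ v(· − b))`. [folklore] -/
theorem integrable_mul_apply_tensorFin_two_right (S₂ : 𝓢((Fin 2 → V), ℂ) →L[ℂ] ℂ)
    (h u v : 𝓢(V, ℂ)) :
    Integrable fun b : V => h b * S₂ (SchwartzMap.tensorFin 2 ![u, SchwartzMap.compSubConstCLM ℂ b v]) := by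
  obtain ⟨R, hR⟩ := exists_clm_tensorFin_two_right (E := V) u
  simp_rw [← hR]
  have key := SchwartzAverage.integrable_mul_apply_compSubConstCLM (ContinuousLinearMap.id ℝ V) h
    (S₂.comp R) v
  simp only [ContinuousLinearMap.coe_comp, Function.comp_apply, ContinuousLinearMap.coe_id',
    id_eq] at key
  exact key

/-- Integrability of `a ↦ h(a) 𝔖₁(u(· − a))`. [folklore] -/
theorem integrable_mul_apply_tensorFin_one (S₁ : 𝓢((Fin 1 → V), ℂ) →L[ℂ] ℂ) (h u : 𝓢(V, ℂ)) :
    Integrable fun a : V => h a * S₁ (SchwartzMap.tensorFin 1 ![SchwartzMap.compSubConstCLM ℂ a u]) := by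
  obtain ⟨L, hL⟩ := exists_clm_tensorFin_one (E := V)
  simp_rw [← hL]
  have key := SchwartzAverage.integrable_mul_apply_compSubConstCLM (ContinuousLinearMap.id ℝ V) h
    (S₁.comp L) u
  simp only [ContinuousLinearMap.coe_comp, Function.comp_apply, ContinuousLinearMap.coe_id',
    id_eq] at key
  exact key

/-- Double superposition: `𝔖₂((h₁ ⋆ u) ⊗ (h₂ ⋆ v)) = ∫ h₁(a) ∫ h₂(b) 𝔖₂(u(· − a) ⊗ v(· − b)) db da`. [folklore] -/
theorem apply_tensorFin_two_translationAverage (S₂ : 𝓢((Fin 2 → V), ℂ) →L[ℂ] ℂ)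
    (h₁ h₂ u v : 𝓢(V, ℂ)) :
    S₂ (SchwartzMap.tensorFin 2
        ![SchwartzAverage.translationAverage (ContinuousLinearMap.id ℝ V) h₁ u,
          SchwartzAverage.translationAverage (ContinuousLinearMap.id ℝ V) h₂ v]) =
      ∫ a, h₁ a * ∫ b, h₂ b * S₂ (SchwartzMap.tensorFin 2
        ![SchwartzMap.compSubConstCLM ℂ a u, SchwartzMap.compSubConstCLM ℂ b v]) := by
  rw [apply_tensorFin_two_translationAverage_left]
  refine integral_congr_ae (Eventually.of_forall fun a => ?_)
  simp only
  rw [apply_tensorFin_two_translationAverage_right]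

/-- The algebra of the truncation under a double superposition: with integrable pieces,
`∫ h₁ ∫ h₂ A − (∫ h₁ Bᵤ)(∫ h₂ Bᵥ) = ∫ h₁(a) ∫ h₂(b) (A(a,b) − Bᵤ(a) Bᵥ(b))` (constants out of
integrals, `integral_sub`; no Fubini). [folklore] -/
theorem integral_integral_sub_mul {α : Type*} [MeasurableSpace α] {μ : Measure α}
    (h₁ h₂ Bu Bv : α → ℂ) (A : α → α → ℂ)
    (hA : ∀ a, Integrable (fun b => h₂ b * A a b) μ)
    (hIA : Integrable (fun a => h₁ a * ∫ b, h₂ b * A a b ∂μ) μ)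
    (hBu : Integrable (fun a => h₁ a * Bu a) μ) (hBv : Integrable (fun b => h₂ b * Bv b) μ) :
    (∫ a, h₁ a * ∫ b, h₂ b * A a b ∂μ ∂μ) - (∫ a, h₁ a * Bu a ∂μ) * (∫ b, h₂ b * Bv b ∂μ) =
      ∫ a, h₁ a * ∫ b, h₂ b * (A a b - Bu a * Bv b) ∂μ ∂μ := by
  have inner : ∀ a, ∫ b, h₂ b * (A a b - Bu a * Bv b) ∂μ =
      (∫ b, h₂ b * A a b ∂μ) - Bu a * ∫ b, h₂ b * Bv b ∂μ := by
    intro a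
    have hre : (fun b => h₂ b * (A a b - Bu a * Bv b)) =
        fun b => h₂ b * A a b - Bu a * (h₂ b * Bv b) := by
      funext b; ring
    rw [hre, integral_sub (hA a) (hBv.const_mul (Bu a)), integral_const_mul]
  simp_rw [inner]
  have hre : (fun a => h₁ a * ((∫ b, h₂ b * A a b ∂μ) - Bu a * ∫ b, h₂ b * Bv b ∂μ)) =
      fun a => h₁ a * (∫ b, h₂ b * A a b ∂μ) - h₁ a * Bu a * ∫ b, h₂ b * Bv b ∂μ := by
    funext a; ring
  rw [hre, integral_sub hIA (hBu.mul_const _), integral_mul_const]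

/-- **Superposition formula for the truncated two-point functional**:
`W(h₁ ⋆ u, h₂ ⋆ v) = ∫ h₁(a) ∫ h₂(b) W(u(· − a), v(· − b)) db da`,
`W(x, y) = 𝔖₂(x ⊗ y) − 𝔖₁(x) 𝔖₁(y)`. [folklore] -/
theorem truncated_translationAverage (S₂ : 𝓢((Fin 2 → V), ℂ) →L[ℂ] ℂ)
    (S₁ : 𝓢((Fin 1 → V), ℂ) →L[ℂ] ℂ) (h₁ h₂ u v : 𝓢(V, ℂ)) :
    S₂ (SchwartzMap.tensorFin 2
        ![SchwartzAverage.translationAverage (ContinuousLinearMap.id ℝ V) h₁ u,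
          SchwartzAverage.translationAverage (ContinuousLinearMap.id ℝ V) h₂ v]) -
      S₁ (SchwartzMap.tensorFin 1 ![SchwartzAverage.translationAverage (ContinuousLinearMap.id ℝ V) h₁ u]) *
        S₁ (SchwartzMap.tensorFin 1 ![SchwartzAverage.translationAverage (ContinuousLinearMap.id ℝ V) h₂ v]) =
      ∫ a, h₁ a * ∫ b, h₂ b *
        (S₂ (SchwartzMap.tensorFin 2 ![SchwartzMap.compSubConstCLM ℂ a u, SchwartzMap.compSubConstCLM ℂ b v]) -
          S₁ (SchwartzMap.tensorFin 1 ![SchwartzMap.compSubConstCLM ℂ a u]) *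
            S₁ (SchwartzMap.tensorFin 1 ![SchwartzMap.compSubConstCLM ℂ b v])) := by
  rw [apply_tensorFin_two_translationAverage S₂ h₁ h₂ u v,
    apply_tensorFin_one_translationAverage S₁ h₁ u, apply_tensorFin_one_translationAverage S₁ h₂ v]
  refine integral_integral_sub_mul h₁ h₂
    (fun a => S₁ (SchwartzMap.tensorFin 1 ![SchwartzMap.compSubConstCLM ℂ a u]))
    (fun b => S₁ (SchwartzMap.tensorFin 1 ![SchwartzMap.compSubConstCLM ℂ b v]))
    (fun a b => S₂ (SchwartzMap.tensorFin 2
      ![SchwartzMap.compSubConstCLM ℂ a u, SchwartzMap.compSubConstCLM ℂ b v]))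
    (fun a => integrable_mul_apply_tensorFin_two_right S₂ h₂ _ v) ?_
    (integrable_mul_apply_tensorFin_one S₁ h₁ u) (integrable_mul_apply_tensorFin_one S₁ h₂ v)
  refine (integrable_mul_apply_tensorFin_two_left S₂ h₁ u
    (SchwartzAverage.translationAverage (ContinuousLinearMap.id ℝ V) h₂ v)).congr
    (Eventually.of_forall fun a => ?_)
  simp only
  rw [apply_tensorFin_two_translationAverage_right]

end Superposition

/-! ### Sign of an integral from the sign of the integrand's real part -/

/-- `0 ≤ Re ∫ F` as soon as `0 ≤ Re F` pointwise (if `F` is integrable, `Re ∫ F = ∫ Re F`;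
otherwise the integral is `0`). [folklore] -/
theorem re_integral_nonneg {α : Type*} [MeasurableSpace α] {μ : Measure α} {F : α → ℂ}
    (hF : ∀ a, 0 ≤ (F a).re) : 0 ≤ (∫ a, F a ∂μ).re := by
  by_cases hi : Integrable F μ
  · have h := integral_re hi
    simp only [RCLike.re_to_complex] at h
    rw [← h]
    exact integral_nonneg hF
  · simp [integral_undef hi]

/-! ### Fixed kernel: non-negativity of `W(φ ⋆ f, φ ⋆ g)` -/

section Fixed

variable {V : Type*} [NormedAddCommGroup V] [InnerProductSpace ℝ V] [FiniteDimensional ℝ V]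
  [MeasurableSpace V] [BorelSpace V]

/-- **Smeared separated pairs are non-negative**: if `0 ≤ Re W(φ(· − a), φ(· − b))` whenever
`dist a b > 2ρ`, `f, g` are real non-negative and `δ`-separated with `2ρ < δ`, then
`0 ≤ Re W(φ ⋆ f, φ ⋆ g)` — superposition (`truncated_translationAverage`) and the sign of the
integrand: `Re(f(a) g(b) W) = f(a) g(b) Re W ≥ 0`, charged pairs being `≥ δ > 2ρ` apart. [folklore] -/
theorem re_truncated_translationAverage_nonneg (S₂ : 𝓢((Fin 2 → V), ℂ) →L[ℂ] ℂ)
    (S₁ : 𝓢((Fin 1 → V), ℂ) →L[ℂ] ℂ) (φ₀ f g : 𝓢(V, ℂ)) {ρ δ : ℝ} (hρδ : 2 * ρ < δ)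
    (hbump : ∀ a b : V, 2 * ρ < dist a b →
      0 ≤ (S₂ (SchwartzMap.tensorFin 2
          ![SchwartzMap.compSubConstCLM ℂ a φ₀, SchwartzMap.compSubConstCLM ℂ b φ₀]) -
        S₁ (SchwartzMap.tensorFin 1 ![SchwartzMap.compSubConstCLM ℂ a φ₀]) *
          S₁ (SchwartzMap.tensorFin 1 ![SchwartzMap.compSubConstCLM ℂ b φ₀])).re)
    (hfg : ∀ x, (f x).im = 0 ∧ 0 ≤ (f x).re ∧ (g x).im = 0 ∧ 0 ≤ (g x).re)
    (hsep : ∀ x ∈ tsupport (f : V → ℂ), ∀ y ∈ tsupport (g : V → ℂ), δ ≤ dist x y) :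
    0 ≤ (S₂ (SchwartzMap.tensorFin 2
        ![SchwartzAverage.translationAverage (ContinuousLinearMap.id ℝ V) φ₀ f,
          SchwartzAverage.translationAverage (ContinuousLinearMap.id ℝ V) φ₀ g]) -
      S₁ (SchwartzMap.tensorFin 1 ![SchwartzAverage.translationAverage (ContinuousLinearMap.id ℝ V) φ₀ f]) *
        S₁ (SchwartzMap.tensorFin 1
          ![SchwartzAverage.translationAverage (ContinuousLinearMap.id ℝ V) φ₀ g])).re := by
  rw [translationAverage_comm φ₀ f, translationAverage_comm φ₀ g, truncated_translationAverage]
  refine re_integral_nonneg fun a => ?_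
  by_cases ha : a ∈ tsupport (f : V → ℂ)
  swap
  · simp [image_eq_zero_of_notMem_tsupport ha]
  rw [Complex.mul_re, (hfg a).1, zero_mul, sub_zero]
  refine mul_nonneg (hfg a).2.1 (re_integral_nonneg fun b => ?_)
  by_cases hb : b ∈ tsupport (g : V → ℂ)
  swap
  · simp [image_eq_zero_of_notMem_tsupport hb]
  rw [Complex.mul_re, (hfg b).2.2.1, zero_mul, sub_zero]
  exact mul_nonneg (hfg b).2.2.2 (hbump a b (hρδ.trans_le (hsep a ha b hb)))

end Fixed

/-! ### The stub -/

/-- `stub_nonnegSeparated` — **non-negativity of the truncated two-point function on separated non-negative pairs**,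
GIVEN bump-pair non-negativity for a mass-one shrinking kernel family and the approximate-identity property of that
family: `W(f,g) = limₙ W(φₙ ⋆ f, φₙ ⋆ g)` (continuity of `𝔖₂ ∘ tensorFin`, `𝔖₁`) and
`W(φₙ ⋆ f, φₙ ⋆ g) = ∫∫ f(a) g(b) W(φₙ,a, φₙ,b) da db ≥ 0` (superposition of translates twice,
`SchwartzAverage.integral_mul_apply_compSubConstCLM`; every charged pair is at distance `≥ δ > 2rₙ`). [folklore] -/
theorem stub_nonnegSeparated :
    (∀ (ι : Type) (d : ℕ) [NeZero d] (T : OSData ι d) (s : ι)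
      (φ : ℕ → 𝓢(EuclideanSpace ℝ (Fin d), ℂ)) (r : ℕ → ℝ),
      (∀ n, 0 < r n) → Tendsto r atTop (𝓝 0) →
      (∀ n x, (φ n x).im = 0 ∧ 0 ≤ (φ n x).re) → (∀ n, ∫ x, φ n x = 1) →
      (∀ n, tsupport (φ n : EuclideanSpace ℝ (Fin d) → ℂ) ⊆ Metric.closedBall 0 (r n)) →
      (∀ u : 𝓢(EuclideanSpace ℝ (Fin d), ℂ),
        Tendsto (fun n => Literature.Analysis.FunctionSpaces.SchwartzAverage.translationAverage
          (ContinuousLinearMap.id ℝ (EuclideanSpace ℝ (Fin d))) (φ n) u) atTop (𝓝 u)) →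
      (∀ n (a b : EuclideanSpace ℝ (Fin d)), 2 * r n < dist a b →
        0 ≤ (T.schwinger 2 (fun _ => s) (SchwartzMap.tensorFin 2
            ![SchwartzMap.compSubConstCLM ℂ a (φ n), SchwartzMap.compSubConstCLM ℂ b (φ n)]) -
          T.schwinger 1 (fun _ => s) (SchwartzMap.tensorFin 1 ![SchwartzMap.compSubConstCLM ℂ a (φ n)]) *
            T.schwinger 1 (fun _ => s) (SchwartzMap.tensorFin 1 ![SchwartzMap.compSubConstCLM ℂ b (φ n)])).re) →
      ∀ (f g : 𝓢(EuclideanSpace ℝ (Fin d), ℂ)),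
        (∀ x, (f x).im = 0 ∧ 0 ≤ (f x).re ∧ (g x).im = 0 ∧ 0 ≤ (g x).re) →
        (∃ δ : ℝ, 0 < δ ∧ ∀ x ∈ tsupport (f : EuclideanSpace ℝ (Fin d) → ℂ),
          ∀ y ∈ tsupport (g : EuclideanSpace ℝ (Fin d) → ℂ), δ ≤ dist x y) →
        0 ≤ (T.schwinger 2 (fun _ => s) (SchwartzMap.tensorFin 2 ![f, g]) -
          T.schwinger 1 (fun _ => s) (SchwartzMap.tensorFin 1 ![f]) *
            T.schwinger 1 (fun _ => s) (SchwartzMap.tensorFin 1 ![g])).re) := by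
  intro ι d _ T s φ r _ hr0 _ _ _ happrox hbump f g hfg hsep
  obtain ⟨δ, hδ, hsep⟩ := hsep
  -- (1) LIMIT: `W(φₙ ⋆ f, φₙ ⋆ g) → W(f, g)`
  have hf := happrox f
  have hg := happrox g
  have h2 : Tendsto (fun n => SchwartzMap.tensorFin 2
      ![SchwartzAverage.translationAverage (ContinuousLinearMap.id ℝ _) (φ n) f,
        SchwartzAverage.translationAverage (ContinuousLinearMap.id ℝ _) (φ n) g]) atTop
      (𝓝 (SchwartzMap.tensorFin 2 ![f, g])) := by
    refine ((continuous_tensorFin 2).tendsto _).comp ?_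
    rw [tendsto_pi_nhds]
    intro i
    fin_cases i
    · simpa using hf
    · simpa using hg
  have h1 : ∀ u : 𝓢(EuclideanSpace ℝ (Fin d), ℂ), Tendsto (fun n => SchwartzMap.tensorFin 1
      ![SchwartzAverage.translationAverage (ContinuousLinearMap.id ℝ _) (φ n) u]) atTop
      (𝓝 (SchwartzMap.tensorFin 1 ![u])) := by
    intro u
    refine ((continuous_tensorFin 1).tendsto _).comp ?_
    rw [tendsto_pi_nhds]
    intro i
    fin_cases i
    simpa using happrox u
  have hlim := (Complex.continuous_re.tendsto _).comp
    ((((T.schwinger 2 fun _ => s).continuous.tendsto _).comp h2).sub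
      ((((T.schwinger 1 fun _ => s).continuous.tendsto _).comp (h1 f)).mul
        (((T.schwinger 1 fun _ => s).continuous.tendsto _).comp (h1 g))))
  refine ge_of_tendsto hlim ?_
  -- (2)+(3) for all `n` with `2 rₙ < δ`
  filter_upwards [hr0.eventually (eventually_lt_nhds (half_pos hδ))] with n hn
  have h2r : 2 * r n < δ := by linarith
  exact re_truncated_translationAverage_nonneg (T.schwinger 2 fun _ => s) (T.schwinger 1 fun _ => s)
    (φ n) f g h2r (hbump n) hfg hsep

end Summit.QuantumFields.YangMills.Cruxes.ContinuumLegGivenGap.DualitySelectionNloSkewness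

end
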